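import Summits.QuantumFields.BalabanUV.Beta.FP.CovarianceRowSum
import Summits.QuantumFields.BalabanUV.Beta.GAN24.AveragedPropagatorInverseUniform
import Literature.MathematicalPhysics.QuantumFieldTheory.Balaban1983to89.Beta.VectorTailsCov

/-!
# `BalabanUV.Beta.FP.CovarianceConstraintRowSum` — road «FP» (binder row D1), lane IR-5′, **THE (T0′) SUPPLIER CHAIN, FILE 3: THE CONSTRAINT
# SANDWICH LETTER `cC` IS IN THE TREE** — `Σ_j ‖(Q*·(QGQ*)⁻¹·Q) i j‖ ≤ (d+1)(a + c₀)·latticeConst(d+1, δ₀)` uniformly in `n` and in the torus,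
# from gan24's `AveragedPropagatorInverseUniform.exists_QGQ_inv_sup` ((QGQ*)⁻¹ = Δ_k + a, exp-local) BY NAME, the row sums `‖Q‖_{∞→∞} = ‖Q*‖_{∞→∞} = 1`,
# and `CovarianceRowSum.rowSum_mul_le`; hence the hard covariance's row-sum letter with `cG` AND `cC` discharged — ONLY the two coarse-projected
# scalar gradient letters `cA`, `cB` remain (our bookkeeping)

HONEST DEPENDENCY (page 1, mandatory): continuum YM on T⁴ ⇐ BetaPertH ∧ nine spine estimates (0/9 proved); BetaPertH ⇐ (D1) ∧ (D4) ∧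
CAP+tail; G-an2-4 gates asym, D1 and NE2/3/4.  HONEST FRAMING (cell contract, verbatim): «discharging `BetaPertH` makes Bałaban's UV
stability UNCONDITIONAL — a real constructive-QFT result; it is NOT the continuum limit and NOT the Clay problem.»  THIS MODULE is row-sum bookkeeping
over tree theorems BY NAME (`B5Hk160Torus.QvOp_constV`, `Beta.VectorTailsCov.sum_norm_QvOp_col`, gan24 `exists_QGQ_inv_sup`, pv15 `B5G115RowSum.row_sum_le_of_mulVec_bound`,
this lineage's `CovarianceRowSum`); it cites nothing as a hypothesis, mints no `Prop`, has no `def`, 0 sorry; no estimate of ours.  NOT (T0′) (the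
letters `cA`, `cB` — `‖∂·Δ⁻¹·R‖_{∞→∞}`, `‖R·Δ⁻¹·∂ᴴ‖_{∞→∞}` = scalar `G′` gradient entries × `‖R‖_{∞→∞}` — stay displayed), NOT hslice, NOT (ASYMP),
NOT D1, NOT BetaPertH, NOT continuum, NOT Clay.

ABSOLUTE RULE (cell charter, verbatim): «No internally-minted statement may enter as a cited fact. Every hypothesis is either kernel-proved in this
package or a verbatim quotation of a PUBLISHED theorem with page reference. The manuscript(s) under audit are NOT citable for their own disputed
steps — they are the thing under adjudication; programme-internal (2001/route/tribunal) claims are never citable.»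

CONTENT (`M : Fin (d+1) → ℕ` as in pv15 ∕ gan24).  §1 `QvOp_eq_ofReal_norm`, **`sum_norm_QvOp_row`** (`Σ_i ‖Q b i‖ = 1`: entries real `≥ 0`, `Q·1 = 1` by `QvOp_constV`),
**`sum_norm_QvAdj_row`** (`Σ_b ‖Q* i b‖ = 1`: `Q* = n^{d+1}·Qᴴ`, `VectorTailsCov.sum_norm_QvOp_col`); §2 **`exists_rowSum_QGQ_inv_le`** (gan24's sup form by
duality), **`exists_rowSum_constraint_le`** (`∃ cC(d, a), ∀ n M i, Σ_j ‖(Q*·(QGQ*)⁻¹·Q) i j‖ ≤ cC`); §3 **`rowSum_Cov_one_le_of_scalar_letters`**: at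
`a = 1`, `∀ i, Σ_j ‖𝒞 i j‖ ≤ cG + cA·cB + cG·cC·cG` with `cG` (pv15) AND `cC` (gan24) DISCHARGED — only `hA`, `hB` displayed.
Unit `b2b-balaban-beta-d1-formalise-leaf-05` (gen 18), 2026-08-21; `LEAVES-FP.md` row «(T0′) CHAIN FILE 3».  «not in print; our bookkeeping».
-/

noncomputable section

open scoped BigOperators Matrix ComplexConjugate

namespace Summit.QuantumFields.BalabanUV.Beta.FP.CovarianceConstraintRowSum

open Literature.MathematicalPhysics.QuantumFieldTheory.Balaban1983to89
open Literature.MathematicalPhysics.QuantumFieldTheory.Balaban1983to89.B5Prop11Plancherel (Tor fine calG)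
open Literature.MathematicalPhysics.QuantumFieldTheory.Balaban1983to89.B5Action121 (GradOp)
open Literature.MathematicalPhysics.QuantumFieldTheory.Balaban1983to89.B5Block118 (QvOp)
open Literature.MathematicalPhysics.QuantumFieldTheory.Balaban1983to89.B5LaplaceInverse (LapSinv)
open Literature.MathematicalPhysics.QuantumFieldTheory.Balaban1983to89.B5DeltaA169 (QvAdj)
open Literature.MathematicalPhysics.QuantumFieldTheory.Balaban1983to89.B5Identities197Torus (RT)
open Literature.MathematicalPhysics.QuantumFieldTheory.Balaban1983to89.B5Hk160Torus (constV QvOp_constV)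
open Literature.MathematicalPhysics.QuantumFieldTheory.Balaban1983to89.B4TorusKernel (periodConst)
open Literature.MathematicalPhysics.QuantumFieldTheory.Balaban1983to89.B5G183Strip (kappa183)
open Literature.MathematicalPhysics.QuantumFieldTheory.Balaban1983to89.B5G183CovDecay (MD183)
open Literature.MathematicalPhysics.QuantumFieldTheory.Balaban1983to89.B4Sect5Proof (latticeConst)
open Literature.MathematicalPhysics.QuantumFieldTheory.Balaban1983to89.B5G115RowSum (row_sum_le_of_mulVec_bound)
open Literature.MathematicalPhysics.QuantumFieldTheory.Balaban1983to89.Beta.FluctuationProjection (Cov QGQ)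
open Literature.MathematicalPhysics.QuantumFieldTheory.Balaban1983to89.Beta.VectorTailsCov (QvOp_apply_eq norm_QvOp_apply sum_norm_QvOp_col)
open Summit.QuantumFields.BalabanUV.Beta.GAN24.AveragedPropagatorInverseUniform (exists_QGQ_inv_sup)
open Summit.QuantumFields.BalabanUV.Beta.FP.CovarianceRowSum (rowSum_mul_le rowSum_Cov_one_le)

variable {d : ℕ} (n : ℕ) [NeZero n] (M : Fin (d + 1) → ℕ) [hM : ∀ μ, NeZero (M μ)]

/-! ## §1 The averaging operator and its adjoint have unit row sums -/

omit [NeZero n] hM in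
/-- [folklore] the entries of `Q` are nonnegative reals: `Q b i = ‖Q b i‖` (`VectorTailsCov.QvOp_apply_eq` ∕ `norm_QvOp_apply`). -/
theorem QvOp_eq_ofReal_norm (b : Tor M × Fin (d + 1)) (i : Tor (fine n M) × Fin (d + 1)) :
    QvOp n M b i = ((‖QvOp n M b i‖ : ℝ) : ℂ) := by
  obtain ⟨y, μ⟩ := b
  obtain ⟨x, κ⟩ := i
  rw [norm_QvOp_apply, QvOp_apply_eq]
  split_ifs with h
  · push_cast
    congr 1
    refine Finset.sum_congr rfl fun j _ => Finset.sum_congr rfl fun t _ => ?_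
    split_ifs <;> simp
  · simp

/-- [folklore] **`‖Q‖_{∞→∞} = 1`**: every row of the (1.18) averaging operator sums to one (`Q` of the constant `1` is `1`, `B5Hk160Torus.QvOp_constV`). -/
theorem sum_norm_QvOp_row (b : Tor M × Fin (d + 1)) : ∑ i, ‖QvOp n M b i‖ = 1 := by
  have h := congrFun (QvOp_constV n M (fun _ : Fin (d + 1) => (1 : ℂ))) b
  rw [Matrix.mulVec, dotProduct] at h
  simp only [constV, mul_one] at h
  have h' : ((∑ i, ‖QvOp n M b i‖ : ℝ) : ℂ) = 1 := by
    rw [← h]; push_cast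
    exact Finset.sum_congr rfl fun i _ => (QvOp_eq_ofReal_norm n M b i).symm
  exact_mod_cast h'

/-- [folklore] **`‖Q*‖_{∞→∞} = 1`**: every row of `Q* = n^{d+1}·Qᴴ` sums to one (`VectorTailsCov.sum_norm_QvOp_col`: the columns of `Q` sum to `n^{−(d+1)}`). -/
theorem sum_norm_QvAdj_row (i : Tor (fine n M) × Fin (d + 1)) : ∑ b, ‖QvAdj n M i b‖ = 1 := by
  have hn : (n : ℝ) ≠ 0 := Nat.cast_ne_zero.mpr (NeZero.ne n)
  have hcol := sum_norm_QvOp_col n M i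
  simp only [QvAdj, Matrix.smul_apply, Matrix.conjTranspose_apply, smul_eq_mul, norm_mul, Complex.norm_pow, Complex.norm_natCast,
    norm_star, ← Finset.mul_sum]
  rw [hcol]
  field_simp

/-! ## §2 The constraint sandwich's row-sum letter, from gan24's uniform inverse -/

/-- [our bookkeeping] **ROW SUMS OF `(QGQ*)⁻¹`, uniformly**: gan24's `exists_QGQ_inv_sup` read by pv15's duality `row_sum_le_of_mulVec_bound`. -/
theorem exists_rowSum_QGQ_inv_le :
    ∃ c₀ δ₀ : ℝ, 0 < c₀ ∧ 0 < δ₀ ∧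
      ∀ (n : ℕ) [NeZero n] (hn : 1 ≤ n) (M : Fin (d + 1) → ℕ) [∀ μ, NeZero (M μ)] (a : ℝ) (ha : 0 < a) (q : Tor M × Fin (d + 1)),
        ∑ q', ‖(QGQ n hn M a ha)⁻¹ q q'‖ ≤ (d + 1) * (a + c₀) * latticeConst (d + 1) δ₀ := by
  obtain ⟨c₀, δ₀, hc, hδ, h⟩ := exists_QGQ_inv_sup (d := d)
  refine ⟨c₀, δ₀, hc, hδ, fun n _ hn M _ a ha q => ?_⟩
  refine row_sum_le_of_mulVec_bound _ (fun J hJ q'' => ?_) q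
  simpa only [mul_one] using h n hn M a ha J 1 hJ q''

/-- [our bookkeeping] **`cC` — THE CONSTRAINT SANDWICH LETTER**: `∃ c₀ δ₀ > 0` (d-only) with
`Σ_j ‖(Q*·(QGQ*)⁻¹·Q) i j‖ ≤ (d+1)(a + c₀)·latticeConst(d+1, δ₀)` for every `n ≥ 1`, torus `M`, `a > 0`, row `i`. -/
theorem exists_rowSum_constraint_le :
    ∃ c₀ δ₀ : ℝ, 0 < c₀ ∧ 0 < δ₀ ∧
      ∀ (n : ℕ) [NeZero n] (hn : 1 ≤ n) (M : Fin (d + 1) → ℕ) [∀ μ, NeZero (M μ)] (a : ℝ) (ha : 0 < a) (i : Tor (fine n M) × Fin (d + 1)),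
        ∑ j, ‖(QvAdj n M * (QGQ n hn M a ha)⁻¹ * QvOp n M) i j‖ ≤ (d + 1) * (a + c₀) * latticeConst (d + 1) δ₀ := by
  obtain ⟨c₀, δ₀, hc, hδ, h⟩ := exists_rowSum_QGQ_inv_le (d := d)
  refine ⟨c₀, δ₀, hc, hδ, fun n _ hn M _ a ha i => ?_⟩
  haveI : Nonempty (Tor M × Fin (d + 1)) := ⟨(0, 0)⟩
  have h1 : ∀ i', ∑ q, ‖(QvAdj n M * (QGQ n hn M a ha)⁻¹) i' q‖ ≤ 1 * ((d + 1) * (a + c₀) * latticeConst (d + 1) δ₀) :=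
    rowSum_mul_le (fun i' => (sum_norm_QvAdj_row n M i').le) (h n hn M a ha)
  haveI : Nonempty (Tor (fine n M) × Fin (d + 1)) := ⟨i⟩
  have h2 := rowSum_mul_le h1 (fun q => (sum_norm_QvOp_row n M q).le) i
  linarith

/-! ## §3 The hard covariance's row-sum letter with `cG` and `cC` discharged -/

/-- [our bookkeeping] **TWO LETTERS DOWN**: at `a = 1`, for every `N ≥ d`, there are d-only `c₀ δ₀ > 0` such that for every `n ≥ 1`, every torus,
every row `i`, and ANY row-sum letters `cA`, `cB` of the coarse-projected free gradient kernels `∂·Δ⁻¹·R`, `R·Δ⁻¹·∂ᴴ`,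
`Σ_j ‖𝒞 i j‖ ≤ cG + cA·cB + cG·cC·cG` with `cG = C(d,N)` (pv15) and `cC = (d+1)(1 + c₀)·latticeConst(d+1, δ₀)` (gan24). -/
theorem rowSum_Cov_one_le_of_scalar_letters {Nn : ℕ} (hN : d + 1 ≤ Nn + 1) :
    ∃ c₀ δ₀ : ℝ, 0 < c₀ ∧ 0 < δ₀ ∧
      ∀ (n : ℕ) [NeZero n] (hn : 1 ≤ n) (M : Fin (d + 1) → ℕ) [∀ μ, NeZero (M μ)] {cA cB : ℝ},
        (∀ i, ∑ j, ‖(GradOp (fine n M) (n : ℂ) * LapSinv (fine n M) (n : ℂ) * RT n M) i j‖ ≤ cA) →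
        (∀ i, ∑ j, ‖(RT n M * LapSinv (fine n M) (n : ℂ) * (GradOp (fine n M) (n : ℂ))ᴴ) i j‖ ≤ cB) →
        ∀ i : Tor (fine n M) × Fin (d + 1), ∑ j, ‖Cov n hn M 1 one_pos i j‖
          ≤ (2 * Nn * 2 ^ Nn * Real.exp (1 / (2 * (d + 1))) * latticeConst (d + 1) (1 / (2 * (d + 1)))
              + (d + 1) * (MD183 (d + 1) Nn * periodConst (kappa183 (d + 1)) d * latticeConst (d + 1) (kappa183 (d + 1) / (d + 1))))
            + cA * cB
            + (2 * Nn * 2 ^ Nn * Real.exp (1 / (2 * (d + 1))) * latticeConst (d + 1) (1 / (2 * (d + 1)))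
              + (d + 1) * (MD183 (d + 1) Nn * periodConst (kappa183 (d + 1)) d * latticeConst (d + 1) (kappa183 (d + 1) / (d + 1))))
              * ((d + 1) * (1 + c₀) * latticeConst (d + 1) δ₀)
              * (2 * Nn * 2 ^ Nn * Real.exp (1 / (2 * (d + 1))) * latticeConst (d + 1) (1 / (2 * (d + 1)))
              + (d + 1) * (MD183 (d + 1) Nn * periodConst (kappa183 (d + 1)) d * latticeConst (d + 1) (kappa183 (d + 1) / (d + 1)))) := by
  obtain ⟨c₀, δ₀, hc, hδ, h⟩ := exists_rowSum_constraint_le (d := d)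
  refine ⟨c₀, δ₀, hc, hδ, fun n _ hn M _ cA cB hA hB i => ?_⟩
  exact rowSum_Cov_one_le n hn M hN hA hB (h n hn M 1 one_pos) i

end Summit.QuantumFields.BalabanUV.Beta.FP.CovarianceConstraintRowSum

end
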